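import Summits.AtomisticToContinuum.Crystallization.Theorems.FreeSplittingCertificatesStrictSplittingRuleFarPencilP1Hypotheses

/-!
# `StrictSplittingRule` (stmt-AtomisticToContinuum-12560): LIPSCHITZ continuity of a continuous cellwise-affine field, and the far theorem from cellwise data

Route `FreeSplittingCertificates`, crux r3 `StrictSplittingRule` (H12⋆ = `stub_coreJointCoercive`), unit b2b-freesplit-B gen 18.
VALUE = the last generic hypothesis of the P1-class far theorem (`farPencil4_weighted_integral_le_of_locallyAffine`,
`…FarPencilFlux4LocallyAffine`): hypothesis (i) `LipschitzWith K v` for the interpolant.  With `…FarPencilP1Hypotheses` (null faces, local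
affinity, affine tail, the ledger's weight) the far half of the H12⋆ assembly now follows from purely COMBINATORIAL data about the interpolant
(`farPencil4_weighted_integral_le_of_cellwise`: a continuous field, affine with `‖L‖ ≤ K` on each cell of a cover whose cell frontiers lie in a
locally finite family of flat faces, affine outside a ball) — item (2) of HOME FAR-LEMMA-SPEC §15 (d) is reduced to constructing that object and
the transfer inequalities.  NOT a proof of H12⋆, NOT summit progress.

* `norm_sub_le_of_deriv_interior`, `norm_sub_le_of_deriv_off_finset` — mean-value inequality `‖g b − g a‖ ≤ C(b−a)` for `g` continuous on
  `[a,b]` with some derivative of norm `≤ C` at every interior point off a FINITE set (shrinking sub-intervals + continuity; induction on the set);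
* `line_mem_affineSubspace_of_two` — a line meeting an affine subspace twice lies in it;
* **`lipschitzWith_of_locallyAffine_off_faces`** — `v` continuous, locally affine with `‖L‖ ≤ K` off the union of a locally finite family of
  faces `F i ⊆ P i` (proper affine subspaces, countably many) ⇒ `LipschitzWith K v` (sup norms): a segment from a point off all the planes meets
  each plane — hence each face — at most once and only finitely many faces; such points are dense (`⋃ P i` is null) and `v` is continuous;
* **`farPencil4_weighted_integral_le_of_cellwise`** (+ instance D `farPencilD_weighted_integral_le_of_cellwise`).
HONEST FRAMING: elementary real analysis; the interpolant object itself, the element transfer and the near certificate are separate items;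
NOT a proof of H12⋆, NOT summit progress.
-/

noncomputable section

open MeasureTheory Topology Filter Set Metric
open scoped NNReal

namespace Summit.AtomisticToContinuum.Crystallization.Theorems.StrictSplittingRuleBirth

/-! ## A mean-value inequality with finitely many exceptional points -/

/-- No exceptional points: if `g` is continuous on `[a,b]` and at every point of `(a,b)` has SOME derivative of norm `≤ C`, then
`‖g b − g a‖ ≤ C(b − a)` (Mathlib's segment estimate on shrinking closed sub-intervals + continuity at the endpoints). -/
theorem norm_sub_le_of_deriv_interior {F : Type*} [NormedAddCommGroup F] [NormedSpace ℝ F] {g : ℝ → F}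
    {a b C : ℝ} (hab : a ≤ b) (hcont : ContinuousOn g (Icc a b))
    (hder : ∀ t ∈ Ioo a b, ∃ w : F, HasDerivAt g w t ∧ ‖w‖ ≤ C) : ‖g b - g a‖ ≤ C * (b - a) := by
  rcases eq_or_lt_of_le hab with rfl | hlt
  · simp
  classical
  -- a derivative function on (a,b)
  set g' : ℝ → F := fun t => if h : t ∈ Ioo a b then Classical.choose (hder t h) else 0 with hg'
  have hg'd : ∀ t ∈ Ioo a b, HasDerivAt g (g' t) t ∧ ‖g' t‖ ≤ C := fun t ht => by
    have h := Classical.choose_spec (hder t ht)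
    simp only [hg', dif_pos ht]
    exact h
  -- shrink: a_n = a + δ_n, b_n = b − δ_n, δ_n = (b − a)/(n + 3)
  set δ : ℕ → ℝ := fun n => (b - a) / ((n : ℝ) + 3) with hδ
  have hδpos : ∀ n, 0 < δ n := fun n => by positivity
  have hδlt : ∀ n, 2 * δ n < b - a := fun n => by
    have h : δ n < (b - a) / 2 := by
      simp only [hδ]
      exact div_lt_div_of_pos_left (by linarith) (by norm_num) (by linarith [(Nat.cast_nonneg n : (0:ℝ) ≤ n)])
    linarith
  have h1 : Tendsto (fun n : ℕ => 1 / ((n : ℝ) + 3)) atTop (𝓝 0) := by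
    have h : Tendsto ((fun n : ℕ => 1 / ((n : ℝ) + 1)) ∘ (fun n : ℕ => n + 2)) atTop (𝓝 0) :=
      (tendsto_one_div_add_atTop_nhds_zero_nat (𝕜 := ℝ)).comp (tendsto_add_atTop_nat 2)
    refine Filter.Tendsto.congr (fun n => ?_) h
    simp only [Function.comp_apply]
    push_cast
    ring
  have hδto : Tendsto δ atTop (𝓝 0) := by
    have h := h1.const_mul (b - a)
    rw [mul_zero] at h
    refine Filter.Tendsto.congr (fun n => ?_) h
    simp only [hδ]
    ring
  -- the estimate on [a + δ, b − δ]
  have hstep : ∀ n, ‖g (b - δ n) - g (a + δ n)‖ ≤ C * (b - a) := by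
    intro n
    have h1 : a < a + δ n := by linarith [hδpos n]
    have h2 : b - δ n < b := by linarith [hδpos n]
    have h12 : a + δ n ≤ b - δ n := by linarith [hδlt n]
    have hsub : Icc (a + δ n) (b - δ n) ⊆ Ioo a b := fun t ht => ⟨lt_of_lt_of_le h1 ht.1, lt_of_le_of_lt ht.2 h2⟩
    have hd : ∀ t ∈ Icc (a + δ n) (b - δ n), HasDerivWithinAt g (g' t) (Icc (a + δ n) (b - δ n)) t :=
      fun t ht => (hg'd t (hsub ht)).1.hasDerivWithinAt
    have hb : ∀ t ∈ Ico (a + δ n) (b - δ n), ‖g' t‖ ≤ C := fun t ht => (hg'd t (hsub ⟨ht.1, ht.2.le⟩)).2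
    have h := norm_image_sub_le_of_norm_deriv_le_segment' hd hb (b - δ n) (right_mem_Icc.2 h12)
    have hC0 : 0 ≤ C := le_trans (norm_nonneg _) (hg'd _ ⟨h1, lt_of_le_of_lt h12 h2⟩).2
    calc ‖g (b - δ n) - g (a + δ n)‖ ≤ C * (b - δ n - (a + δ n)) := h
      _ ≤ C * (b - a) := by nlinarith [hδpos n]
  -- pass to the limit
  have hta : Tendsto (fun n => a + δ n) atTop (𝓝 a) := by simpa using tendsto_const_nhds.add hδto
  have htb : Tendsto (fun n => b - δ n) atTop (𝓝 b) := by simpa using tendsto_const_nhds.sub hδto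
  have hmem_a : ∀ n, a + δ n ∈ Icc a b := fun n => ⟨by linarith [hδpos n], by linarith [hδlt n, hδpos n]⟩
  have hmem_b : ∀ n, b - δ n ∈ Icc a b := fun n => ⟨by linarith [hδlt n, hδpos n], by linarith [hδpos n]⟩
  have hga : Tendsto (fun n => g (a + δ n)) atTop (𝓝 (g a)) :=
    ((hcont a (left_mem_Icc.2 hab)).tendsto.comp (tendsto_nhdsWithin_iff.2 ⟨hta, Eventually.of_forall hmem_a⟩))
  have hgb : Tendsto (fun n => g (b - δ n)) atTop (𝓝 (g b)) :=
    ((hcont b (right_mem_Icc.2 hab)).tendsto.comp (tendsto_nhdsWithin_iff.2 ⟨htb, Eventually.of_forall hmem_b⟩))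
  have hlim : Tendsto (fun n => ‖g (b - δ n) - g (a + δ n)‖) atTop (𝓝 ‖g b - g a‖) := (hgb.sub hga).norm
  exact le_of_tendsto' hlim hstep

/-- **Finitely many exceptional points**: if `g` is continuous on `[a,b]` and at every point of `(a,b)` outside a finite set `T` has some
derivative of norm `≤ C`, then `‖g b − g a‖ ≤ C(b − a)` (induction on `T`, splitting at an exceptional point). -/
theorem norm_sub_le_of_deriv_off_finset {F : Type*} [NormedAddCommGroup F] [NormedSpace ℝ F] {g : ℝ → F} {C : ℝ}
    (T : Finset ℝ) :
    ∀ {a b : ℝ}, a ≤ b → ContinuousOn g (Icc a b) → (∀ t ∈ Ioo a b, t ∉ T → ∃ w : F, HasDerivAt g w t ∧ ‖w‖ ≤ C) →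
      ‖g b - g a‖ ≤ C * (b - a) := by
  induction T using Finset.strongInduction with
  | H T ih =>
    intro a b hab hcont hder
    by_cases hT : ∃ c ∈ T, c ∈ Ioo a b
    · obtain ⟨c, hcT, hc⟩ := hT
      have hsub : T.erase c ⊂ T := Finset.erase_ssubset hcT
      have hl : ‖g c - g a‖ ≤ C * (c - a) := by
        refine ih _ hsub hc.1.le (hcont.mono (Icc_subset_Icc_right hc.2.le)) (fun t ht htn => ?_)
        exact hder t ⟨ht.1, ht.2.trans hc.2⟩ (fun h => htn (Finset.mem_erase.2 ⟨ht.2.ne, h⟩))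
      have hr : ‖g b - g c‖ ≤ C * (b - c) := by
        refine ih _ hsub hc.2.le (hcont.mono (Icc_subset_Icc_left hc.1.le)) (fun t ht htn => ?_)
        exact hder t ⟨hc.1.trans ht.1, ht.2⟩ (fun h => htn (Finset.mem_erase.2 ⟨ht.1.ne', h⟩))
      calc ‖g b - g a‖ = ‖(g b - g c) + (g c - g a)‖ := by congr 1; abel
        _ ≤ ‖g b - g c‖ + ‖g c - g a‖ := norm_add_le _ _
        _ ≤ C * (b - c) + C * (c - a) := add_le_add hr hl
        _ = C * (b - a) := by ring
    · simp only [not_exists, not_and] at hT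
      exact norm_sub_le_of_deriv_interior hab hcont (fun t ht => hder t ht (fun h => hT t h ht))

/-! ## Lines and affine subspaces -/

/-- If two distinct parameters of the line `t ↦ x + t(y − x)` land in an affine subspace, the whole line does. -/
theorem line_mem_affineSubspace_of_two {P : AffineSubspace ℝ (Fin 3 → ℝ)} {x y : Fin 3 → ℝ} {t₁ t₂ : ℝ}
    (h₁ : x + t₁ • (y - x) ∈ P) (h₂ : x + t₂ • (y - x) ∈ P) (hne : t₁ ≠ t₂) (t : ℝ) : x + t • (y - x) ∈ P := by
  have hr : t₂ - t₁ ≠ 0 := sub_ne_zero.2 (Ne.symm hne)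
  have hmem := AffineMap.lineMap_mem ((t - t₁) / (t₂ - t₁)) h₁ h₂
  have heq : AffineMap.lineMap (x + t₁ • (y - x)) (x + t₂ • (y - x)) ((t - t₁) / (t₂ - t₁)) = x + t • (y - x) := by
    rw [AffineMap.lineMap_apply_module]
    ext i
    simp only [Pi.add_apply, Pi.smul_apply, Pi.sub_apply, smul_eq_mul]
    field_simp
    ring
  rw [heq] at hmem
  exact hmem

/-! ## Lipschitz continuity of a continuous field that is locally affine off locally finitely many flat faces -/

/-- **Lipschitz from cellwise data.**  Let `v : ℝ³ → ℝ³` be continuous and, near every point OFF the union of a locally finite family of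
"faces" `F i` — each contained in a proper affine subspace `P i` (its plane), countably many — equal to an affine map with linear part of
operator norm `≤ K` on a ball.  Then `v` is `K`-Lipschitz (sup norms).  (A segment from a point off all the PLANES meets each plane, hence each
face, at most once, and by local finiteness only finitely many faces: the mean-value inequality with finitely many exceptional points gives the
bound from such points; they are dense (`⋃ P i` is null), and `v` is continuous.)  This is hypothesis (i) of
`farPencil4_weighted_integral_le_of_locallyAffine` for the P1 interpolant of a lattice displacement (faces = the element faces).
NOT a proof of H12⋆, NOT summit progress. -/
theorem lipschitzWith_of_locallyAffine_off_faces {ι : Type*} [Countable ι] {F : ι → Set (Fin 3 → ℝ)}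
    {P : ι → AffineSubspace ℝ (Fin 3 → ℝ)} (hFP : ∀ i, F i ⊆ (P i : Set (Fin 3 → ℝ))) (hP : ∀ i, P i ≠ ⊤)
    (hlf : LocallyFinite F) {v : (Fin 3 → ℝ) → (Fin 3 → ℝ)} (hcont : Continuous v) {K : ℝ≥0}
    (hloc : ∀ x, x ∉ (⋃ i, F i) → ∃ r > 0, ∃ L : (Fin 3 → ℝ) →L[ℝ] (Fin 3 → ℝ),
      ‖L‖ ≤ K ∧ ∀ y ∈ ball x r, v y = v x + L (y - x)) :
    LipschitzWith K v := by
  -- Step 1: the bound from every point off all the planes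
  have step1 : ∀ x, x ∉ (⋃ i, (P i : Set (Fin 3 → ℝ))) → ∀ y, ‖v y - v x‖ ≤ K * ‖y - x‖ := by
    intro x hx y
    set γ : ℝ → (Fin 3 → ℝ) := fun t => x + t • (y - x) with hγ
    have hγc : Continuous γ := by fun_prop
    have hγ0 : γ 0 = x := by simp [hγ]
    have hγ1 : γ 1 = y := by simp [hγ]
    -- faces met by the segment: finitely many
    have hK : IsCompact (γ '' Icc 0 1) := (isCompact_Icc.image hγc)
    have hfin : {i | (F i ∩ γ '' Icc 0 1).Nonempty}.Finite := hlf.finite_nonempty_inter_compact hK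
    -- each plane is met at most once
    have hsub1 : ∀ i, ({t : ℝ | γ t ∈ (P i : Set (Fin 3 → ℝ))}).Subsingleton := by
      intro i t₁ h₁ t₂ h₂
      by_contra hne
      exact hx (mem_iUnion.2 ⟨i, by simpa [hγ] using line_mem_affineSubspace_of_two h₁ h₂ hne 0⟩)
    have hTfin : (⋃ i ∈ {i | (F i ∩ γ '' Icc 0 1).Nonempty}, {t : ℝ | γ t ∈ F i}).Finite :=
      hfin.biUnion fun i _ => ((hsub1 i).anti fun t ht => hFP i ht).finite
    set T : Finset ℝ := hTfin.toFinset with hT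
    -- off T (inside (0,1)) the point γ t is off all faces
    have hoff : ∀ t ∈ Ioo (0:ℝ) 1, t ∉ T → γ t ∉ ⋃ i, F i := by
      intro t ht htT hmem
      obtain ⟨j, hj⟩ := mem_iUnion.1 hmem
      apply htT
      rw [hT, Set.Finite.mem_toFinset]
      refine mem_iUnion₂.2 ⟨j, ⟨γ t, hj, ⟨t, ⟨ht.1.le, ht.2.le⟩, rfl⟩⟩, hj⟩
    -- derivative of v ∘ γ off T
    have hder : ∀ t ∈ Ioo (0:ℝ) 1, t ∉ T → ∃ w : Fin 3 → ℝ, HasDerivAt (v ∘ γ) w t ∧ ‖w‖ ≤ K * ‖y - x‖ := by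
      intro t ht htT
      obtain ⟨r, hr, L, hLK, hL⟩ := hloc (γ t) (hoff t ht htT)
      refine ⟨L (y - x), ?_, (L.le_opNorm _).trans (mul_le_mul_of_nonneg_right hLK (norm_nonneg _))⟩
      -- near t, v (γ s) = v (γ t) + (s - t) • L (y - x)
      have hlin : HasDerivAt (fun s : ℝ => v (γ t) + (s - t) • L (y - x)) (L (y - x)) t := by
        have h := ((hasDerivAt_id t).sub_const t).smul_const (L (y - x))
        simpa using h.const_add (v (γ t))
      refine hlin.congr_of_eventuallyEq ?_
      have hballs : ∀ᶠ s in 𝓝 t, γ s ∈ ball (γ t) r := by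
        have : ContinuousAt γ t := hγc.continuousAt
        exact this.preimage_mem_nhds (ball_mem_nhds _ hr)
      filter_upwards [hballs] with s hs
      rw [Function.comp_apply, hL (γ s) hs, map_sub]
      have e : γ s - γ t = (s - t) • (y - x) := by simp only [hγ]; module
      rw [← map_sub, e, map_smul]
    have hcg : ContinuousOn (v ∘ γ) (Icc 0 1) := (hcont.comp hγc).continuousOn
    have h := norm_sub_le_of_deriv_off_finset T zero_le_one hcg hder
    simpa [hγ0, hγ1, Function.comp_apply] using h
  -- Step 2: density of the complement of the planes + continuity
  have hnull : volume (⋃ i, (P i : Set (Fin 3 → ℝ))) = 0 := volume_iUnion_affineSubspace_eq_zero P hP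
  have hdense : Dense (⋃ i, (P i : Set (Fin 3 → ℝ)))ᶜ := by
    rw [← interior_eq_empty_iff_dense_compl]
    by_contra hne
    have hpos := Measure.measure_pos_of_nonempty_interior (μ := volume) (Set.nonempty_iff_ne_empty.2 hne)
    exact hpos.ne' hnull
  refine LipschitzWith.of_dist_le_mul fun x y => ?_
  have hclosed : IsClosed {x : Fin 3 → ℝ | dist (v x) (v y) ≤ K * dist x y} :=
    isClosed_le (by fun_prop) (by fun_prop)
  have hsubset : (⋃ i, (P i : Set (Fin 3 → ℝ)))ᶜ ⊆ {x : Fin 3 → ℝ | dist (v x) (v y) ≤ K * dist x y} := by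
    intro x hx
    have h := step1 x hx y
    simp only [mem_setOf_eq, dist_eq_norm]
    rwa [norm_sub_rev (v y) (v x), norm_sub_rev y x] at h
  have huniv : univ ⊆ {x : Fin 3 → ℝ | dist (v x) (v y) ≤ K * dist x y} :=
    hdense.closure_eq ▸ closure_minimal hsubset hclosed
  exact huniv (mem_univ x)

/-! ## The far theorem from cellwise data -/

/-- Local affinity WITH the norm bound: if `v = c_i + L_i` on `cells i` with `‖L_i‖ ≤ K` and the cell frontiers lie in `S`, then off `S`
the field is affine on a ball with linear part of norm `≤ K`. -/
theorem locallyAffine_norm_of_cellwise_affine {ι : Type*} {v : (Fin 3 → ℝ) → (Fin 3 → ℝ)} {cells : ι → Set (Fin 3 → ℝ)}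
    {S : Set (Fin 3 → ℝ)} {K : ℝ≥0} (hcover : ∀ x, ∃ i, x ∈ cells i)
    (haff : ∀ i, ∃ (c : Fin 3 → ℝ) (L : (Fin 3 → ℝ) →L[ℝ] (Fin 3 → ℝ)), ‖L‖ ≤ K ∧ ∀ y ∈ cells i, v y = c + L y)
    (hS : ∀ i, frontier (cells i) ⊆ S) :
    ∀ x, x ∉ S → ∃ r > 0, ∃ L : (Fin 3 → ℝ) →L[ℝ] (Fin 3 → ℝ), ‖L‖ ≤ K ∧ ∀ y ∈ ball x r, v y = v x + L (y - x) := by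
  intro x hx
  obtain ⟨i, hi⟩ := hcover x
  obtain ⟨c, L, hLK, hL⟩ := haff i
  have hint : x ∈ interior (cells i) := by
    rw [← self_sdiff_frontier]
    exact ⟨hi, fun h => hx (hS i h)⟩
  obtain ⟨r, hr, hball⟩ := Metric.isOpen_iff.1 isOpen_interior x hint
  refine ⟨r, hr, L, hLK, fun y hy => ?_⟩
  have hy' : y ∈ cells i := interior_subset (hball hy)
  rw [hL y hy', hL x hi, map_sub]
  abel

/-- **THE FAR HALF FROM CELLWISE DATA.**  Let `N(f_S,f_A,D,C) + div(aΦ₁+bΦ₂+cΦ₃+nΨ₁) ≤ t·Den` hold at every `x ≠ 0`.  Let `v : ℝ³ → ℝ³` be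
CONTINUOUS, equal on each cell of a cover to an affine map with linear part of norm `≤ K`, the cell frontiers lying in the union of a locally
finite, countable family of faces `F k`, each inside a proper affine subspace `P k` (its plane), and let `v` be affine (`b₀ + y·A`) for
`‖y‖ ≥ R`.  Then with the ledger's weight `χ = fpChi R₁² R₂²` (`0 < R₁ < R₂`):
`∫ χ²·N(v) ≤ t·∫ χ²·Den(v) + ∫ 2χ⟪∇χ, Φ(v)⟫` (gradients = `fderiv`, i.e. the cell gradients off the faces).
NOT a proof of H12⋆, NOT summit progress. -/
theorem farPencil4_weighted_integral_le_of_cellwise {fS fA D C a b c n t : ℝ}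
    (hcert : ∀ (x w : Fin 3 → ℝ) (G : Fin 3 → Fin 3 → ℝ), x ≠ 0 → fpNumI fS fA D C x w G + fpDivFlux4 a b c n x w G ≤ t * fpDen x G)
    {ι κ : Type*} [Countable κ] {v : (Fin 3 → ℝ) → (Fin 3 → ℝ)} {cells : ι → Set (Fin 3 → ℝ)} {F : κ → Set (Fin 3 → ℝ)}
    {P : κ → AffineSubspace ℝ (Fin 3 → ℝ)} {K : ℝ≥0} {R R1 R2 : ℝ} {b₀ : Fin 3 → ℝ} {A : Fin 3 → Fin 3 → ℝ}
    (hcont : Continuous v) (hcover : ∀ x, ∃ i, x ∈ cells i)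
    (haff : ∀ i, ∃ (c : Fin 3 → ℝ) (L : (Fin 3 → ℝ) →L[ℝ] (Fin 3 → ℝ)), ‖L‖ ≤ K ∧ ∀ y ∈ cells i, v y = c + L y)
    (hfront : ∀ i, frontier (cells i) ⊆ ⋃ k, F k) (hFP : ∀ k, F k ⊆ (P k : Set (Fin 3 → ℝ))) (hP : ∀ k, P k ≠ ⊤)
    (hlf : LocallyFinite F) (hR1 : 0 < R1) (hR12 : R1 < R2)
    (htail : ∀ y : Fin 3 → ℝ, R ≤ ‖y‖ → ∀ j, v y j = b₀ j + (y 0 * A 0 j + y 1 * A 1 j + y 2 * A 2 j)) :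
    ∫ x, fpChi (R1 ^ 2) (R2 ^ 2) x ^ 2 * fpNumI fS fA D C x (v x) (fpGrad v x) ≤
      t * (∫ x, fpChi (R1 ^ 2) (R2 ^ 2) x ^ 2 * fpDen x (fpGrad v x)) +
        ∫ x, 2 * fpChi (R1 ^ 2) (R2 ^ 2) x * fpFlux4DotGrad a b c n v (fpChi (R1 ^ 2) (R2 ^ 2)) x := by
  have hlocK := locallyAffine_norm_of_cellwise_affine hcover haff hfront
  have hLip : LipschitzWith K v := lipschitzWith_of_locallyAffine_off_faces hFP hP hlf hcont hlocK
  have hS : volume (⋃ k, F k) = 0 :=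
    volume_eq_zero_of_subset_iUnion_affineSubspace P hP (iUnion_mono hFP)
  have hloc : ∀ x, x ∉ (⋃ k, F k) → ∃ r > 0, ∃ L : (Fin 3 → ℝ) →L[ℝ] (Fin 3 → ℝ), ∀ y ∈ ball x r, v y = v x + L (y - x) :=
    fun x hx => by
      obtain ⟨r, hr, L, -, hL⟩ := hlocK x hx
      exact ⟨r, hr, L, hL⟩
  exact farPencil4_weighted_integral_le_fpChi hcert hR1 hR12 hLip hS hloc htail

/-- **Instance: certificate D from cellwise data** (`t = 9/40`; the recommended target).  NOT a proof of H12⋆, NOT summit progress. -/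
theorem farPencilD_weighted_integral_le_of_cellwise {ι κ : Type*} [Countable κ] {v : (Fin 3 → ℝ) → (Fin 3 → ℝ)}
    {cells : ι → Set (Fin 3 → ℝ)} {F : κ → Set (Fin 3 → ℝ)} {P : κ → AffineSubspace ℝ (Fin 3 → ℝ)} {K : ℝ≥0} {R R1 R2 : ℝ}
    {b₀ : Fin 3 → ℝ} {A : Fin 3 → Fin 3 → ℝ} (hcont : Continuous v) (hcover : ∀ x, ∃ i, x ∈ cells i)
    (haff : ∀ i, ∃ (c : Fin 3 → ℝ) (L : (Fin 3 → ℝ) →L[ℝ] (Fin 3 → ℝ)), ‖L‖ ≤ K ∧ ∀ y ∈ cells i, v y = c + L y)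
    (hfront : ∀ i, frontier (cells i) ⊆ ⋃ k, F k) (hFP : ∀ k, F k ⊆ (P k : Set (Fin 3 → ℝ))) (hP : ∀ k, P k ≠ ⊤)
    (hlf : LocallyFinite F) (hR1 : 0 < R1) (hR12 : R1 < R2)
    (htail : ∀ y : Fin 3 → ℝ, R ≤ ‖y‖ → ∀ j, v y j = b₀ j + (y 0 * A 0 j + y 1 * A 1 j + y 2 * A 2 j)) :
    ∫ x, fpChi (R1 ^ 2) (R2 ^ 2) x ^ 2 * fpNumI (7 / 4) (7 / 4) (6 / 5) (9 / 10) x (v x) (fpGrad v x) ≤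
      9 / 40 * (∫ x, fpChi (R1 ^ 2) (R2 ^ 2) x ^ 2 * fpDen x (fpGrad v x)) +
        ∫ x, 2 * fpChi (R1 ^ 2) (R2 ^ 2) x *
          fpFlux4DotGrad (7 / 45) (23 / 30) (-(19 / 40)) (3 / 40) v (fpChi (R1 ^ 2) (R2 ^ 2)) x :=
  farPencil4_weighted_integral_le_of_cellwise farPencilCert_D hcont hcover haff hfront hFP hP hlf hR1 hR12 htail

end Summit.AtomisticToContinuum.Crystallization.Theorems.StrictSplittingRuleBirth
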